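import Literature.NumberTheory.LFunctions.DeBruijnHSimpleZerosProofs
import Literature.NumberTheory.LFunctions.DeBruijnNewmanConstProofs
import Literature.NumberTheory.LFunctions.RodgersTaoEnergyProofs
import Literature.NumberTheory.LFunctions.ZetaArgVariation
import HarnessLib

/-!
# Rodgers–Tao 2020: the zeros of `H_0` are `2γ_n` with distinct `γ_n` (discharge of
`Literature.NumberTheory.LFunctions.rodgers_tao_zeros_zero` from the Csordas–Smith–Varga theorem)

Trunk T-ANT (`Literature/NumberTheory/LFunctions`). Proofs only (no new definitions, no named
facts; `criticalOrdinates T` below is a local notation for `{γ ∈ (0, T] | ζ(½ + iγ) = 0}`). Companion of `RodgersTaoEnergy.lean`,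
whose named fact

> `Literature.NumberTheory.LFunctions.rodgers_tao_zeros_zero`: if some `H_t`, `t < 0`, has only real zeros (`Λ < 0`), then
> `x_{n+1}(0) = 2γ_n` for all `n` and the ordinates `γ_n` of the zeros of `ζ` are distinct

(Rodgers–Tao 2020, §1.2: "Let `Λ < t ≤ 0`, then the zeroes of `H_t` are all real […] It is a
result of Csordas, Smith, and Varga that the zeroes are also distinct and avoid the origin", and
§9: "the points `x_j(0)` are twice the imaginary ordinates of nontrivial zeroes of the Riemann
zeta function") is here **proved** from

* the Csordas–Smith–Varga theorem `Literature.NumberTheory.LFunctions.csordasSmithVarga_simple_zeros`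
  (`DeBruijnHSimpleZeros.lean`; CSV 1994, Thm. 2.2) — itself discharged in
  `DeBruijnHSimpleZerosProofs.lean` (`Literature.NumberTheory.LFunctions.csordasSmithVarga_simple_zeros_holds`), so that the
  final results below need only `N(T) → ∞` — and
* `Literature.NumberTheory.LFunctions.tendsto_zetaZeroCount_atTop` (`N(T) → ∞`, a consequence of the Riemann–von Mangoldt
  formula, `Literature.NumberTheory.LFunctions.riemann_von_mangoldt.tendsto_zetaZeroCount_atTop`, which is an input of the
  Rodgers–Tao assembly anyway),

using the discharged prelude of `DeBruijnNewmanConstProofs.lean` (de Bruijn's monotonicity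
`Literature.NumberTheory.LFunctions.mono_deBruijnH_holds`, `RH ↔ H_0` has only real zeros, `H_0 = ξ(½ + iz/2)/8`),
`Literature.NumberTheory.LFunctions.riemannXi_eq_zero_iff_holds` and the zero-counting API of `ZetaZerosProofs.lean` /
`ZeroCountingProofs.lean`.

## The argument

1. `Λ < 0` gives `H_0` real-rooted (monotonicity) and RH.
2. For real `x`, `H_0(x) = 0 ↔ ζ(½ + ix/2) = 0` (`H_0 = ξ/8`, `ξ = 0 ↔ ζ = 0` in the strip).
3. `H_0'(z) = (i/16) ξ'(½ + iz/2)` and, at a zero `ρ` of `ζ` with `Re ρ > 0`,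
   `ζ'(ρ) = ξ'(ρ) · 2/(ρ(ρ−1)) · Γ_ℝ(ρ)⁻¹`; so a simple real zero `2γ` of `H_0` (CSV) gives
   `ζ'(½ + iγ) ≠ 0`, i.e. multiplicity `m(½ + iγ) = 1` (`riemannZetaZeroOrder`, analytic order).
4. Under RH the box `{ζ = 0, 0 < Im ρ ≤ T}` is `{½ + iγ : γ ∈ (0,T], ζ(½+iγ) = 0}`, so with all
   multiplicities `1`, `N(T) = #{γ ∈ (0, T] | ζ(½ + iγ) = 0}` and
   `N_0([0, X]) = #{x ∈ [0,X] | H_0(x) = 0} = N(X/2)` (`H_0(0) ≠ 0`).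
5. `x_{n+1}(0) = inf {X ≥ 0 | n+1 ≤ N_0([0,X])} = inf (2 • {T | n+1 ≤ N(T)}) = 2γ_n`.
6. `N` jumps by at most `1` at every height (one point `½ + iγ` per height, multiplicity `1`),
   so `γ_n = γ_{n+1}` is impossible once the infima are attained (`N(T) → ∞`): `StrictMono γ`.

## Main results

* `Literature.NumberTheory.LFunctions.rodgers_tao_zeros_zero_of_csv` :
  `csordasSmithVarga_simple_zeros → tendsto_zetaZeroCount_atTop → RH.rodgers_tao_zeros_zero`.
* `Literature.NumberTheory.LFunctions.rodgers_tao_zeros_zero_holds_of_tendsto` : `rodgers_tao_zeros_zero` from `N(T) → ∞`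
  alone (CSV discharged by `csordasSmithVarga_simple_zeros_holds`).
* Appended: with the Riemann–von Mangoldt formula now discharged in the tree
  (`Literature.NumberTheory.LFunctions.riemann_von_mangoldt_holds`, `Literature.NumberTheory.LFunctions.tendsto_zetaZeroCount_atTop_holds`,
  `ZetaArgVariation.lean`): `Literature.NumberTheory.LFunctions.rodgers_tao_zeros_zero_holds` — **discharge of the named fact
  `Literature.NumberTheory.LFunctions.rodgers_tao_zeros_zero`**.

Rodgers–Tao's Thm. 1.1 itself (`Literature.NumberTheory.LFunctions.rodgers_tao`, `Λ ≥ 0`) is the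
closed theorem `Literature.NumberTheory.LFunctions.rodgers_tao_holds` of `DobnerLemma4Proofs.lean`
(proved along Dobner's independent route). Earlier versions of this file also carried end-to-end
assemblies of Thm. 1.1 from the leaves of the Rodgers–Tao decomposition — `rodgers_tao_of_csv`
(`rodgers_tao` from Thm. 7.2, Prop. 8.2, CSV Thm. 2.2, the Riemann–von Mangoldt formula and the
Selberg–Fujii small-gap theorem), `rodgers_tao_of_heat_flow` (the same without CSV) and
`rodgers_tao_of_heat_flow'` (without CSV and Riemann–von Mangoldt). They were removed on
2026-08-15: their conclusion is the theorem `rodgers_tao_holds`, of which they had become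
restatements (gate alias probe). The composable reductions they chained are unchanged:
`rodgers_tao_zeros_zero_of_csv` (here); `rodgers_tao_energy_bound_zero_of_propagation`
(Thm. 7.2 + Prop. 8.2 + zeros at time `0` ⟹ Prop. 8.1) and
`rodgers_tao_picket_fence_of_energy_bound` (Prop. 8.1 + zeros ⟹ (picketfence)) in
`RodgersTaoEnergyProofs.lean`; `rodgers_tao_of_picket_fence` ((picketfence) + Riemann–von
Mangoldt + Selberg–Fujii ⟹ Thm. 1.1) in `RodgersTaoProofs.lean`.

## References

* B. Rodgers, T. Tao, *The de Bruijn–Newman constant is non-negative*, Forum Math. Pi 8 (2020),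
  e6 = arXiv:1801.05914, §1.2, §9.
* G. Csordas, W. Smith, R. S. Varga, *Lehmer pairs of zeros, the de Bruijn–Newman constant `Λ`,
  and the Riemann Hypothesis*, Constr. Approx. 10 (1994), 107–129, Thm. 2.2.
* E. C. Titchmarsh, *The Theory of the Riemann Zeta-Function*, 2nd ed. (1986), §2.1 (`ξ`),
  §9.1 (`N(T)`), §10.1 (`Ξ`).
-/

noncomputable section

open Complex Filter Set Topology
open scoped Pointwise

namespace Literature.NumberTheory.LFunctions

/-! ## Step 1: `Λ < 0` gives RH and real zeros of `H_0` -/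

/-- Step 1: if some `H_t` with `t < 0` has only real zeros, then so does `H_0` (de Bruijn's
monotonicity, `mono_deBruijnH_holds`). [cite: RodgersTaoFMP2020, §1.2] -/
theorem hasOnlyRealZeros_deBruijnH_zero_of_neg
    (hΛ : ∃ t : ℝ, t < 0 ∧ HasOnlyRealZeros (deBruijnH t)) : HasOnlyRealZeros (deBruijnH 0) := by
  obtain ⟨t, ht, h⟩ := hΛ
  exact mono_deBruijnH_holds ht.le h

/-- Step 1: `Λ < 0` implies the Riemann hypothesis (Rodgers–Tao 2020, §1.2: "In particular this
implies the Riemann hypothesis"). [cite: RodgersTaoFMP2020, §1.2] -/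
theorem riemannHypothesis_of_neg
    (hΛ : ∃ t : ℝ, t < 0 ∧ HasOnlyRealZeros (deBruijnH t)) : RiemannHypothesis :=
  riemannHypothesis_iff_hasOnlyRealZeros_deBruijnH_zero_holds.2
    (hasOnlyRealZeros_deBruijnH_zero_of_neg hΛ)

/-! ## Step 2: real zeros of `H_0` versus zeros of `ζ` on the critical line -/

/-- Step 2: `H_0(x) = 0 ↔ ζ(½ + i x/2) = 0` for real `x` (`H_0 = ξ(½ + iz/2)/8` and `ξ(s) = 0 ↔
ζ(s) = 0` for `0 < Re s < 1`; Titchmarsh §10.1). [cite: Titchmarsh1986, §10.1] -/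
theorem deBruijnH_zero_ofReal_eq_zero_iff (x : ℝ) :
    deBruijnH 0 x = 0 ↔ riemannZeta (1 / 2 + (x / 2 : ℝ) * I) = 0 := by
  rw [deBruijnH_zero_eq_holds, div_eq_zero_iff, or_iff_left (by norm_num),
    riemannXi_eq_zero_iff_holds]
  have hs : (1 / 2 + I * (x : ℂ) / 2 : ℂ) = 1 / 2 + ((x / 2 : ℝ) : ℂ) * I := by
    push_cast; ring
  rw [hs]
  constructor
  · exact fun h ↦ h.1
  · intro h
    refine ⟨h, ?_, ?_⟩ <;> norm_num

/-- Step 2: `H_0(2γ) = 0 ↔ ζ(½ + iγ) = 0` for real `γ` (Rodgers–Tao 2020, §9: "the points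
`x_j(0)` are twice the imaginary ordinates of nontrivial zeroes"). [cite: RodgersTaoFMP2020, §9] -/
theorem deBruijnH_zero_two_mul_eq_zero_iff (γ : ℝ) :
    deBruijnH 0 (2 * γ) = 0 ↔ riemannZeta (1 / 2 + γ * I) = 0 := by
  have := deBruijnH_zero_ofReal_eq_zero_iff (2 * γ)
  push_cast at this
  rw [this, show ((2 : ℂ) * γ / 2) = (γ : ℂ) by ring]


/-! ## Step 3: derivatives — `H_0'` versus `ξ'` versus `ζ'`, and the order of a zero -/

/-- Step 3: `H_0'(z) = ξ'(½ + iz/2) · (i/2) / 8` (chain rule on `H_0 = ξ(½ + iz/2)/8`). [folklore] -/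
theorem deriv_deBruijnH_zero (z : ℂ) :
    deriv (deBruijnH 0) z = deriv riemannXi (1 / 2 + I * z / 2) * (I / 2) / 8 := by
  have hfun : deBruijnH 0 = fun w ↦ riemannXi (1 / 2 + I * w / 2) / 8 :=
    funext deBruijnH_zero_eq_holds
  have ha : HasDerivAt (fun w : ℂ ↦ 1 / 2 + I * w / 2) (I / 2) z := by
    have h1 : HasDerivAt (fun w : ℂ ↦ I * w / 2) (I * 1 / 2) z :=
      ((hasDerivAt_id z).const_mul I).div_const 2
    exact (h1.const_add (1 / 2 : ℂ)).congr_deriv (by ring)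
  have hξ : HasDerivAt riemannXi (deriv riemannXi (1 / 2 + I * z / 2)) (1 / 2 + I * z / 2) :=
    (differentiable_riemannXi _).hasDerivAt
  have hc := (hξ.comp z ha).div_const 8
  rw [hfun]
  exact hc.deriv

/-- Step 3: for `s ≠ 0, 1`, `ζ(s) = ξ(s) · (2/(s(s−1))) · Γ_ℝ(s)⁻¹` (`ξ(s) = ½ s(s−1) Λ(s)`,
`ζ = Λ/Γ_ℝ`; Titchmarsh §2.1). [cite: Titchmarsh1986, §2.1] -/
theorem riemannZeta_eq_riemannXi_mul {s : ℂ} (hs0 : s ≠ 0) (hs1 : s ≠ 1) :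
    riemannZeta s = riemannXi s * (2 / (s * (s - 1)) * (Gammaℝ s)⁻¹) := by
  rw [riemannZeta_def_of_ne_zero hs0, riemannXi_eq_mul_completedRiemannZeta hs0 hs1,
    div_eq_mul_inv]
  have : s * (s - 1) ≠ 0 := mul_ne_zero hs0 (sub_ne_zero.2 hs1)
  field_simp

/-- Step 3: at a zero `ρ` of `ζ` with `Re ρ > 0`, `ρ ≠ 1`:
`ζ'(ρ) = ξ'(ρ) · (2/(ρ(ρ−1))) · Γ_ℝ(ρ)⁻¹` (product rule on the identity of
`riemannZeta_eq_riemannXi_mul`, valid near `ρ`). [folklore] -/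
theorem deriv_riemannZeta_eq_of_zero {ρ : ℂ} (hρ : 0 < ρ.re) (hρ1 : ρ ≠ 1)
    (hz : riemannZeta ρ = 0) :
    deriv riemannZeta ρ = deriv riemannXi ρ * (2 / (ρ * (ρ - 1)) * (Gammaℝ ρ)⁻¹) := by
  have hρ0 : ρ ≠ 0 := fun h ↦ by simp [h] at hρ
  set k : ℂ → ℂ := fun s ↦ 2 / (s * (s - 1)) * (Gammaℝ s)⁻¹ with hk
  have hev : riemannZeta =ᶠ[𝓝 ρ] riemannXi * k := by
    filter_upwards [eventually_ne_nhds hρ0, eventually_ne_nhds hρ1] with s hs0 hs1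
    rw [Pi.mul_apply]
    exact riemannZeta_eq_riemannXi_mul hs0 hs1
  have hkd : DifferentiableAt ℂ k ρ := by
    have h1 : DifferentiableAt ℂ (fun s : ℂ ↦ 2 / (s * (s - 1))) ρ := by
      refine DifferentiableAt.div (differentiableAt_const _) ?_ (mul_ne_zero hρ0 (sub_ne_zero.2 hρ1))
      fun_prop
    exact h1.mul (differentiable_Gammaℝ_inv ρ)
  have hξ : HasDerivAt riemannXi (deriv riemannXi ρ) ρ := (differentiable_riemannXi _).hasDerivAt
  have hprod := hξ.mul hkd.hasDerivAt
  have hξ0 : riemannXi ρ = 0 := by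
    have := riemannZeta_eq_riemannXi_mul hρ0 hρ1
    rw [hz] at this
    have hk0 : k ρ ≠ 0 := by
      simp only [hk]
      exact mul_ne_zero (div_ne_zero two_ne_zero (mul_ne_zero hρ0 (sub_ne_zero.2 hρ1)))
        (inv_ne_zero (Gammaℝ_ne_zero_of_re_pos hρ))
    rcases mul_eq_zero.1 this.symm with h | h
    · exact h
    · exact absurd h hk0
  rw [hev.deriv_eq, hprod.deriv, hξ0, zero_mul, add_zero]


/-- Step 3: a zero `ρ ≠ 1` of `ζ` with `ζ'(ρ) ≠ 0` has multiplicity `m(ρ) = 1`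
(`riemannZetaZeroOrder` is the analytic order at `ρ`). [folklore] -/
theorem riemannZetaZeroOrder_eq_one_of_deriv_ne_zero {ρ : ℂ} (hρ1 : ρ ≠ 1)
    (hz : riemannZeta ρ = 0) (hd : deriv riemannZeta ρ ≠ 0) : riemannZetaZeroOrder ρ = 1 := by
  have ha : AnalyticAt ℂ riemannZeta ρ := analyticOn_riemannZeta ρ hρ1
  have hord : analyticOrderAt riemannZeta ρ = 1 :=
    ha.analyticOrderAt_eq_one_of_zero_deriv_ne_zero hz hd
  rw [riemannZetaZeroOrder, ha.meromorphicOrderAt_eq, hord]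
  rfl

/-- A `finsum` of ones over a finite set is its cardinality. [folklore] -/
theorem toNat_finsum_mem_eq_ncard {S : Set ℂ} (hS : S.Finite) {m : ℂ → ℤ} (h1 : ∀ ρ ∈ S, m ρ = 1) :
    (∑ᶠ ρ ∈ S, m ρ).toNat = S.ncard := by
  rw [finsum_mem_congr rfl h1, finsum_mem_eq_finite_toFinset_sum _ hS, Finset.sum_const,
    Set.ncard_eq_toFinset_card S hS]
  simp


/-- Local notation (not a declaration): `criticalOrdinates T` is the set of ordinates
`γ ∈ (0, T]` of zeros of `ζ` on the critical line, `{γ | γ ∈ (0, T] ∧ ζ(½ + iγ) = 0}`. -/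
local notation3 "criticalOrdinates " T:max =>
  {γ : ℝ | γ ∈ Set.Ioc (0 : ℝ) T ∧ riemannZeta (1 / 2 + (γ : ℂ) * Complex.I) = 0}

/-- Membership in `criticalOrdinates T`, unfolded. [folklore] -/
theorem mem_criticalOrdinates {T γ : ℝ} :
    γ ∈ criticalOrdinates T ↔ (0 < γ ∧ γ ≤ T) ∧ riemannZeta (1 / 2 + γ * I) = 0 := Iff.rfl

/-- The parametrisation `γ ↦ ½ + iγ` of the critical line is injective. [folklore] -/
theorem injective_half_add_mul_I : Function.Injective fun γ : ℝ ↦ (1 / 2 + γ * I : ℂ) := by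
  intro a b h
  have := congrArg Complex.im h
  simpa using this

/-- Step 4: under RH the zeros of `ζ` with `0 < Im ρ ≤ T` (`zetaZeroBox 0 T`) are the points
`½ + iγ`, `γ ∈ (0, T]` an ordinate of a critical zero. [folklore] -/
theorem zetaZeroBox_eq_image_of_riemannHypothesis (hRH : RiemannHypothesis) (T : ℝ) :
    zetaZeroBox 0 T = (fun γ : ℝ ↦ (1 / 2 + γ * I : ℂ)) '' criticalOrdinates T := by
  ext ρ
  simp only [zetaZeroBox, mem_setOf_eq, mem_image]
  constructor
  · rintro ⟨hz, -, -, him, hT⟩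
    have hρ1 : ρ ≠ 1 := fun h ↦ by simp [h] at him
    have htriv : ¬∃ n : ℕ, ρ = -2 * (n + 1) := by
      rintro ⟨n, hn⟩
      rw [hn] at him
      simp at him
    have hre : ρ.re = 1 / 2 := hRH ρ hz htriv hρ1
    refine ⟨ρ.im, ⟨⟨him, hT⟩, ?_⟩, ?_⟩
    · convert hz using 2
      apply Complex.ext <;> simp [hre]
    · apply Complex.ext <;> simp [hre]
  · rintro ⟨γ, ⟨⟨h0, hT⟩, hz⟩, rfl⟩
    refine ⟨hz, ?_, ?_, ?_, ?_⟩
    · simp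
    · norm_num
    · simpa using h0
    · simpa using hT

/-- Step 4: under RH, `{γ ∈ (0, T] | ζ(½ + iγ) = 0}` is finite (`zetaZeroBox_finite`). [folklore] -/
theorem criticalOrdinates_finite (hRH : RiemannHypothesis) (T : ℝ) : (criticalOrdinates T).Finite :=
  Set.Finite.of_finite_image
    (by rw [← zetaZeroBox_eq_image_of_riemannHypothesis hRH]; exact zetaZeroBox_finite 0 T)
    injective_half_add_mul_I.injOn

/-- Step 4: under RH and simplicity of the critical zeros up to height `T`, `N(T)` is the number
of ordinates `γ ∈ (0, T]` (Titchmarsh §9.1, §10.1). [cite: Titchmarsh1986, §9.1] -/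
theorem zetaZeroCount_eq_ncard_criticalOrdinates (hRH : RiemannHypothesis) {T : ℝ}
    (hsimple : ∀ γ ∈ criticalOrdinates T, riemannZetaZeroOrder (1 / 2 + γ * I) = 1) :
    zetaZeroCount T = (criticalOrdinates T).ncard := by
  rw [zetaZeroCount, zetaZeroCountRe,
    toNat_finsum_mem_eq_ncard (zetaZeroBox_finite 0 T) ?_, zetaZeroBox_eq_image_of_riemannHypothesis hRH,
    Set.ncard_image_of_injective _ injective_half_add_mul_I]
  intro ρ hρ
  rw [zetaZeroBox_eq_image_of_riemannHypothesis hRH] at hρ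
  obtain ⟨γ, hγ, rfl⟩ := hρ
  exact hsimple γ hγ


/-! ## Step 5: under `Λ < 0` and CSV, every critical zero is simple -/

/-- Step 5: under `Λ < 0` and the Csordas–Smith–Varga theorem, every zero `½ + iγ` of `ζ` on the
critical line is simple (Rodgers–Tao 2020, §1.2). [cite: RodgersTaoFMP2020, §1.2] -/
theorem riemannZetaZeroOrder_eq_one_of_csv (hcsv : csordasSmithVarga_simple_zeros)
    (hΛ : ∃ t : ℝ, t < 0 ∧ HasOnlyRealZeros (deBruijnH t)) {γ : ℝ}
    (hz : riemannZeta (1 / 2 + γ * I) = 0) : riemannZetaZeroOrder (1 / 2 + γ * I) = 1 := by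
  obtain ⟨t, ht, hreal⟩ := hΛ
  have hH : deBruijnH 0 (2 * γ) = 0 := (deBruijnH_zero_two_mul_eq_zero_iff γ).2 hz
  have hH' : deriv (deBruijnH 0) (2 * γ) ≠ 0 := by
    have := hcsv t 0 ht hreal (2 * γ) (by push_cast; exact hH)
    push_cast at this
    exact this
  have hρ : (1 / 2 + I * (2 * γ) / 2 : ℂ) = 1 / 2 + γ * I := by ring
  rw [deriv_deBruijnH_zero, hρ] at hH'
  have hξ' : deriv riemannXi (1 / 2 + γ * I) ≠ 0 := fun h ↦ hH' (by rw [h]; ring)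
  have hre : (0 : ℝ) < (1 / 2 + γ * I : ℂ).re := by simp
  have hρ1 : (1 / 2 + γ * I : ℂ) ≠ 1 := fun h ↦ by
    have := congrArg Complex.re h
    norm_num at this
  refine riemannZetaZeroOrder_eq_one_of_deriv_ne_zero hρ1 hz ?_
  rw [deriv_riemannZeta_eq_of_zero hre hρ1 hz]
  refine mul_ne_zero hξ' (mul_ne_zero (div_ne_zero two_ne_zero (mul_ne_zero ?_ (sub_ne_zero.2 hρ1)))
    (inv_ne_zero (Gammaℝ_ne_zero_of_re_pos hre)))
  intro h
  have := congrArg Complex.re h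
  norm_num at this

/-- Step 5: hence, under `Λ < 0` and CSV, `N(T) = #{γ ∈ (0, T] | ζ(½ + iγ) = 0}` for every `T`.
[cite: RodgersTaoFMP2020, §1.2] -/
theorem zetaZeroCount_eq_ncard_of_csv (hcsv : csordasSmithVarga_simple_zeros)
    (hΛ : ∃ t : ℝ, t < 0 ∧ HasOnlyRealZeros (deBruijnH t)) (T : ℝ) :
    zetaZeroCount T = (criticalOrdinates T).ncard :=
  zetaZeroCount_eq_ncard_criticalOrdinates (riemannHypothesis_of_neg hΛ) fun _ hγ ↦
    riemannZetaZeroOrder_eq_one_of_csv hcsv hΛ hγ.2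

/-! ## Step 6: `N_0([0, X]) = N(X/2)` -/

/-- Step 6: the real zeros of `H_0` in `[0, X]` are the numbers `2γ`, `γ ∈ (0, X/2]` an ordinate of
a critical zero of `ζ` (`H_0(0) ≠ 0`, `deBruijnH_apply_zero_ne_zero`). [cite: RodgersTaoFMP2020, §9] -/
theorem setOf_deBruijnH_zero_eq_image (X : ℝ) :
    {x : ℝ | x ∈ Icc 0 X ∧ deBruijnH 0 x = 0} = (fun γ : ℝ ↦ 2 * γ) '' criticalOrdinates (X / 2) := by
  ext x
  simp only [mem_setOf_eq, mem_Icc, mem_image]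
  constructor
  · rintro ⟨⟨h0, hX⟩, hz⟩
    have hx0 : x ≠ 0 := by
      rintro rfl
      exact deBruijnH_apply_zero_ne_zero 0 (by simpa using hz)
    have h0' : 0 < x := lt_of_le_of_ne h0 (Ne.symm hx0)
    refine ⟨x / 2, ⟨⟨by linarith, by linarith⟩, ?_⟩, by ring⟩
    rw [← deBruijnH_zero_two_mul_eq_zero_iff]
    push_cast
    rw [show (2 : ℂ) * (x / 2) = x by ring]
    exact hz
  · rintro ⟨γ, ⟨⟨h0, hX⟩, hz⟩, rfl⟩
    exact ⟨⟨by linarith, by linarith⟩, by exact_mod_cast (deBruijnH_zero_two_mul_eq_zero_iff γ).2 hz⟩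

/-- Step 6: under `Λ < 0` and CSV, `N_0([0, X]) = N(X/2)` for every real `X`.
[cite: RodgersTaoFMP2020, §9] -/
theorem deBruijnZeroCount_zero_Icc (hcsv : csordasSmithVarga_simple_zeros)
    (hΛ : ∃ t : ℝ, t < 0 ∧ HasOnlyRealZeros (deBruijnH t)) (X : ℝ) :
    deBruijnZeroCount 0 (Icc 0 X) = zetaZeroCount (X / 2) := by
  rw [deBruijnZeroCount_eq, setOf_deBruijnH_zero_eq_image,
    Set.ncard_image_of_injective _ (mul_right_injective₀ (two_ne_zero (α := ℝ))),
    zetaZeroCount_eq_ncard_of_csv hcsv hΛ]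

/-! ## Step 7: `x_{n+1}(0) = 2γ_n` -/

/-- Step 7: under `Λ < 0` and CSV, `x_{n+1}(0) = 2γ_n` for every `n`
(`inf (2 • S) = 2 inf S`). [cite: RodgersTaoFMP2020, §9] -/
theorem deBruijnZero_zero_succ (hcsv : csordasSmithVarga_simple_zeros)
    (hΛ : ∃ t : ℝ, t < 0 ∧ HasOnlyRealZeros (deBruijnH t)) (n : ℕ) :
    deBruijnZero 0 (n + 1) = 2 * zetaOrdinate n := by
  rw [deBruijnZero_eq, zetaOrdinate]
  have hset : {X : ℝ | 0 ≤ X ∧ n + 1 ≤ deBruijnZeroCount 0 (Icc 0 X)} =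
      (2 : ℝ) • {T : ℝ | n + 1 ≤ zetaZeroCount T} := by
    ext X
    simp only [mem_setOf_eq, deBruijnZeroCount_zero_Icc hcsv hΛ, Set.mem_smul_set, smul_eq_mul]
    constructor
    · rintro ⟨-, hn⟩
      exact ⟨X / 2, hn, by ring⟩
    · rintro ⟨T, hT, rfl⟩
      refine ⟨?_, by simpa using hT⟩
      by_contra hneg
      have : zetaZeroCount T = 0 := zetaZeroCount_eq_zero_of_nonpos (by linarith)
      omega
  rw [hset, Real.sInf_smul_of_nonneg zero_le_two, smul_eq_mul]


/-! ## Step 8: the ordinates are distinct -/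

/-- `N(T) → ∞` makes the defining sets `{T | n + 1 ≤ N(T)}` of the ordinates nonempty
(cf. `riemann_von_mangoldt.nonempty_setOf_succ_le`). [folklore] -/
theorem nonempty_setOf_succ_le_of_tendsto (hN : tendsto_zetaZeroCount_atTop) (n : ℕ) :
    {T : ℝ | n + 1 ≤ zetaZeroCount T}.Nonempty :=
  (Filter.Tendsto.eventually_ge_atTop (show Tendsto zetaZeroCount atTop atTop from hN)
    (n + 1)).exists

/-- Under `N(T) → ∞` the infimum defining `γ_n` is attained: `n + 1 ≤ N(γ_n)` (right-continuity
of `N`; cf. `riemann_von_mangoldt.succ_le_zetaZeroCount`). [cite: Titchmarsh1986, §9.1] -/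
theorem succ_le_zetaZeroCount_of_tendsto (hN : tendsto_zetaZeroCount_atTop) (n : ℕ) :
    n + 1 ≤ zetaZeroCount (zetaOrdinate n) := by
  obtain ⟨δ, hδ, heq⟩ := exists_zetaZeroCount_add_eq (zetaOrdinate n)
  have hlt : sInf {T | n + 1 ≤ zetaZeroCount T} < zetaOrdinate n + δ := by
    change zetaOrdinate n < zetaOrdinate n + δ
    linarith
  obtain ⟨T', hT', hT'lt⟩ := exists_lt_of_csInf_lt (nonempty_setOf_succ_le_of_tendsto hN n) hlt
  rw [← heq]
  exact le_trans hT' (zetaZeroCount_mono hT'lt.le)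

/-- Under `N(T) → ∞`: `γ_n ≤ T ↔ n + 1 ≤ N(T)` (cf. `riemann_von_mangoldt.zetaOrdinate_le_iff`).
[cite: Titchmarsh1986, §9.1] -/
theorem zetaOrdinate_le_iff_of_tendsto (hN : tendsto_zetaZeroCount_atTop) {n : ℕ} {T : ℝ} :
    zetaOrdinate n ≤ T ↔ n + 1 ≤ zetaZeroCount T :=
  ⟨fun hle ↦ (succ_le_zetaZeroCount_of_tendsto hN n).trans (zetaZeroCount_mono hle),
    fun hT ↦ csInf_le (bddBelow_setOf_succ_le_zetaZeroCount n) hT⟩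

/-- Under `N(T) → ∞` the ordinates are non-decreasing (cf. `riemann_von_mangoldt.zetaOrdinate_mono`).
[cite: Titchmarsh1986, §9.1] -/
theorem zetaOrdinate_mono_of_tendsto (hN : tendsto_zetaZeroCount_atTop) : Monotone zetaOrdinate :=
  fun m k hmk ↦ csInf_le_csInf (bddBelow_setOf_succ_le_zetaZeroCount m)
    (nonempty_setOf_succ_le_of_tendsto hN k) fun T (hT : k + 1 ≤ zetaZeroCount T) ↦
      show m + 1 ≤ zetaZeroCount T by omega

/-- Step 8: under `Λ < 0` and CSV, `N` jumps by at most one at each height: for every `γ` there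
is `t < γ` with `N(γ) ≤ N(t) + 1` (one point `½ + iγ` of the critical line per height,
multiplicity one). [cite: RodgersTaoFMP2020, §1.2] -/
theorem exists_lt_zetaZeroCount_le_add_one (hcsv : csordasSmithVarga_simple_zeros)
    (hΛ : ∃ t : ℝ, t < 0 ∧ HasOnlyRealZeros (deBruijnH t)) (γ : ℝ) :
    ∃ t : ℝ, t < γ ∧ zetaZeroCount γ ≤ zetaZeroCount t + 1 := by
  classical
  have hfin : (criticalOrdinates γ \ {γ}).Finite :=
    ((criticalOrdinates_finite (riemannHypothesis_of_neg hΛ) γ).subset sdiff_subset)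
  -- a height `t < γ` above every ordinate `< γ`
  obtain ⟨t, htγ, ht⟩ : ∃ t : ℝ, t < γ ∧ ∀ γ' ∈ criticalOrdinates γ \ {γ}, γ' ≤ t := by
    rcases (hfin.toFinset).eq_empty_or_nonempty with h | h
    · refine ⟨γ - 1, by linarith, fun γ' hγ' ↦ ?_⟩
      have : γ' ∈ hfin.toFinset := hfin.mem_toFinset.2 hγ'
      rw [h] at this
      simp at this
    · refine ⟨hfin.toFinset.max' h, ?_, fun γ' hγ' ↦ hfin.toFinset.le_max' γ' (hfin.mem_toFinset.2 hγ')⟩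
      have hmem := hfin.toFinset.max'_mem h
      rw [hfin.mem_toFinset] at hmem
      obtain ⟨⟨⟨-, hle⟩, -⟩, hne⟩ := hmem
      exact lt_of_le_of_ne hle hne
  refine ⟨t, htγ, ?_⟩
  have hsub : criticalOrdinates γ ⊆ criticalOrdinates t ∪ {γ} := by
    intro γ' hγ'
    by_cases h : γ' = γ
    · exact Or.inr h
    · exact Or.inl ⟨⟨hγ'.1.1, ht γ' ⟨hγ', h⟩⟩, hγ'.2⟩
  rw [zetaZeroCount_eq_ncard_of_csv hcsv hΛ γ, zetaZeroCount_eq_ncard_of_csv hcsv hΛ t]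
  calc (criticalOrdinates γ).ncard ≤ (criticalOrdinates t ∪ {γ}).ncard :=
        Set.ncard_le_ncard hsub
          (((criticalOrdinates_finite (riemannHypothesis_of_neg hΛ) t)).union (finite_singleton γ))
    _ ≤ (criticalOrdinates t).ncard + ({γ} : Set ℝ).ncard := Set.ncard_union_le _ _
    _ = (criticalOrdinates t).ncard + 1 := by rw [Set.ncard_singleton]

/-- Step 8: under `Λ < 0`, CSV and `N(T) → ∞`, the ordinates `γ_n` are strictly increasing
(Rodgers–Tao 2020, §1.2: `0 < x_1(0) < x_2(0) < ⋯`). [cite: RodgersTaoFMP2020, §1.2] -/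
theorem strictMono_zetaOrdinate_of_csv (hcsv : csordasSmithVarga_simple_zeros)
    (hΛ : ∃ t : ℝ, t < 0 ∧ HasOnlyRealZeros (deBruijnH t)) (hN : tendsto_zetaZeroCount_atTop) :
    StrictMono zetaOrdinate := by
  refine strictMono_nat_of_lt_succ fun n ↦ ?_
  have hle : zetaOrdinate n ≤ zetaOrdinate (n + 1) := zetaOrdinate_mono_of_tendsto hN n.le_succ
  refine lt_of_le_of_ne hle fun heq ↦ ?_
  obtain ⟨t, ht, hcount⟩ := exists_lt_zetaZeroCount_le_add_one hcsv hΛ (zetaOrdinate (n + 1))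
  have h1 : n + 1 + 1 ≤ zetaZeroCount (zetaOrdinate (n + 1)) :=
    succ_le_zetaZeroCount_of_tendsto hN (n + 1)
  have h2 : zetaZeroCount t ≤ n := by
    by_contra hlt
    have : zetaOrdinate n ≤ t := (zetaOrdinate_le_iff_of_tendsto hN).2 (by omega)
    rw [heq] at this
    exact absurd this (not_le.2 ht)
  omega

/-! ## Assembly: `rodgers_tao_zeros_zero` from CSV and `N(T) → ∞` -/

/-- **Discharge of `Literature.NumberTheory.LFunctions.rodgers_tao_zeros_zero` relative to the Csordas–Smith–Varga theorem**:
under `Λ < 0`, `x_{n+1}(0) = 2γ_n` for all `n` and `γ` is strictly increasing, from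
`csordasSmithVarga_simple_zeros` (CSV 1994, Thm. 2.2) and `N(T) → ∞`.
[cite: RodgersTaoFMP2020, §1.2 and §9] -/
theorem rodgers_tao_zeros_zero_of_csv (hcsv : csordasSmithVarga_simple_zeros)
    (hN : tendsto_zetaZeroCount_atTop) : LFunctions.rodgers_tao_zeros_zero := fun hΛ ↦
  ⟨deBruijnZero_zero_succ hcsv hΛ, strictMono_zetaOrdinate_of_csv hcsv hΛ hN⟩

/-- **`Literature.NumberTheory.LFunctions.rodgers_tao_zeros_zero` from `N(T) → ∞` alone**: the Csordas–Smith–Varga input of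
`rodgers_tao_zeros_zero_of_csv` is discharged by `csordasSmithVarga_simple_zeros_holds`
(`DeBruijnHSimpleZerosProofs.lean`). (`N(T) → ∞` follows from the Riemann–von Mangoldt formula,
`riemann_von_mangoldt.tendsto_zetaZeroCount_atTop`, or from Hardy's theorem.)
[cite: RodgersTaoFMP2020, §1.2 and §9] -/
theorem rodgers_tao_zeros_zero_holds_of_tendsto (hN : tendsto_zetaZeroCount_atTop) :
    LFunctions.rodgers_tao_zeros_zero :=
  LFunctions.rodgers_tao_zeros_zero_of_csv csordasSmithVarga_simple_zeros_holds hN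

/-! ## Appended: the Riemann–von Mangoldt input discharged -/

/-- **Discharge of `Literature.NumberTheory.LFunctions.rodgers_tao_zeros_zero`** (Rodgers–Tao 2020, §1.2 with §9: under
`Λ < 0`, `x_{n+1}(0) = 2γ_n` and the `γ_n` are distinct): from
`rodgers_tao_zeros_zero_holds_of_tendsto` (Csordas–Smith–Varga discharged) and `N(T) → ∞`, now a
theorem of the tree (`Literature.NumberTheory.LFunctions.tendsto_zetaZeroCount_atTop_holds`, from the Riemann–von Mangoldt
formula `Literature.NumberTheory.LFunctions.riemann_von_mangoldt_holds`, `ZetaArgVariation.lean`).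
[cite: RodgersTaoFMP2020, §1.2 and §9] -/
theorem rodgers_tao_zeros_zero_holds : LFunctions.rodgers_tao_zeros_zero :=
  LFunctions.rodgers_tao_zeros_zero_holds_of_tendsto tendsto_zetaZeroCount_atTop_holds

end Literature.NumberTheory.LFunctions

end
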